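import Summits.Ventures.PercRepro.S1CoreCapSpecSpreadFiveLinesP

/-!
# PercRepro — TOWARDS THE INSTANCE `ν = 6` OF THE SPREAD SPEC (`FourCapSpecSpread capPaper 6 9`): THE NULLITY-GENERIC BASE (p1, gen 32)

`proofs/P1-S2-CORANK6.md` §4h. The search `fourcap_spread3.py` (`maxlines = 12`, 180 states) reads `Q*_spread(6) = 9` (a simple 4-line, a
3-line through it and a disjoint `K₄`); the all-simple configurations reach `8` lines (two disjoint `K₄`). The counts of the `ν = 5` modules
are redone here with the nullity as a parameter, so that the same lemmas serve the all-simple bound at cost `≤ 4` (`≤ 5` lines, needed beside a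
4-line at `ν = 6`) and at cost `≤ 6` (`≤ 9` lines):
* `cost_clause_restrict_gen`: the lines disjoint from a base `b` satisfy the clause at nullity `ν'` whenever `ν + lineRank b ≤ ν' + wsum (unionL b)`;
* `card_le_one_of_cost_one`: at nullity `1` a configuration has one line (two lines cost `≥ 2`);
* `card_filter_disjoint_le_one_gen / _le_two_gen / _le_four_gen`: a base of cost `≥ ν − 1` / `≥ ν − 2` / `≥ ν − 3` leaves `≤ 1` / `≤ 2` / `≤ 4`
  disjoint lines;
* `disjoint_list` / `card_le_nu_of_pairwise_disjoint`: `n` pairwise disjoint simple lines have rank bound `2n` on `3n` points, so `n ≤ ν`;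
* `triangle_of_four_cost_three`: four simple lines of cost `≤ 3` contain a triangle (each lies in the union of the other three, so all pairs meet,
  and a common point of all four is impossible).
Axioms: standard.
-/

namespace PercRepro

namespace S1

namespace FourCap

variable {β : Type} [DecidableEq β]

section GenBase

variable {w : β → ℕ} {ls : Finset (Finset β)}
  (h1 : ∀ L ∈ ls, ∀ v ∈ L, w v = 1 ∨ w v = 2)
  (h2 : ∀ L ∈ ls, 3 ≤ L.card ∧ wsum w L ≤ 5)
  (h3 : ∀ L ∈ ls, ∀ L' ∈ ls, L ≠ L' → (L ∩ L').card ≤ 1)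

/-- **Restriction of the cost clause at any nullity**: lines disjoint from the union of the base `b` satisfy the clause at nullity `ν'` whenever
`ν + lineRank b ≤ ν' + wsum (unionL b)`. -/
theorem cost_clause_restrict_gen {ν : ℕ}
    (h4 : ∀ l : List (Finset β), l.Nodup → (∀ L ∈ l, L ∈ ls) → wsum w (unionL l) ≤ ν + lineRank l)
    {b : List (Finset β)} (hb : b.Nodup) (hbl : ∀ L ∈ b, L ∈ ls) {ν' : ℕ}
    (hcost : ν + lineRank b ≤ ν' + wsum w (unionL b)) (l : List (Finset β)) (hl : l.Nodup) (hll : ∀ L ∈ l, L ∈ ls)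
    (hdisj : ∀ L ∈ l, Disjoint L (unionL b)) (hnot : ∀ L ∈ l, L ∉ b) : wsum w (unionL l) ≤ ν' + lineRank l := by
  have hnd : (l ++ b).Nodup := by
    rw [List.nodup_append']
    exact ⟨hl, hb, hnot⟩
  have hc := h4 (l ++ b) hnd (by
    intro L hL
    rw [List.mem_append] at hL
    rcases hL with h | h
    · exact hll L h
    · exact hbl L h)
  rw [unionL_append_union, wsum_union_of_disjoint w (disjoint_unionL_of_forall hdisj),
    lineRank_append_of_disjoint l b hdisj] at hc
  omega

include h1 h2 h3 in
/-- **At nullity `1` a configuration has at most one line**: two lines have `wsum (L' ∪ L) ≥ 6 − |L' ∩ L|` against `1 + 4 − |L' ∩ L|`. -/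
theorem card_le_one_of_cost_one
    (h4' : ∀ l : List (Finset β), l.Nodup → (∀ L ∈ l, L ∈ ls) → wsum w (unionL l) ≤ 1 + lineRank l) : ls.card ≤ 1 := by
  by_contra hlt
  push Not at hlt
  obtain ⟨L, L', hL, hL', hne⟩ := Finset.one_lt_card_iff.1 hlt
  have h := two_line_cost h4' hL hL' hne.symm
  have hint : (L' ∩ L).card ≤ 1 := h3 L' hL' L hL hne.symm
  have h3L := (h2 L hL).1
  have h3L' := (h2 L' hL').1
  have hsd : (L' \ L).card + (L' ∩ L).card = L'.card := Finset.card_sdiff_add_card_inter _ _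
  have hwu : wsum w (L' ∪ L) = wsum w L + wsum w (L' \ L) := by
    rw [Finset.union_comm]; exact (wsum_union_ge w _ _).symm
  have hc' : (L' \ L).card ≤ wsum w (L' \ L) :=
    card_le_wsum w _ (fun v hv => h1 L' hL' v (Finset.mem_sdiff.1 hv).1)
  have hcL : L.card ≤ wsum w L := card_le_wsum w L (h1 L hL)
  have : min L.card 2 ≤ 2 := min_le_right _ _
  have : min (L' \ L).card (2 - min (L' ∩ L).card 2) ≤ 2 - min (L' ∩ L).card 2 := min_le_right _ _
  omega

include h1 h2 h3 in
/-- **A base of cost `≥ ν − 1` leaves at most one disjoint line.** -/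
theorem card_filter_disjoint_le_one_gen {ν : ℕ}
    (h4 : ∀ l : List (Finset β), l.Nodup → (∀ L ∈ l, L ∈ ls) → wsum w (unionL l) ≤ ν + lineRank l)
    {b : List (Finset β)} (hb : b.Nodup) (hbl : ∀ L ∈ b, L ∈ ls) (hcost : ν + lineRank b ≤ 1 + wsum w (unionL b)) :
    (ls.filter (fun L => Disjoint L (unionL b))).card ≤ 1 := by
  have hD : ∀ L ∈ ls.filter (fun L => Disjoint L (unionL b)), L ∈ ls ∧ Disjoint L (unionL b) :=
    fun L hL => Finset.mem_filter.1 hL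
  refine card_le_one_of_cost_one (fun L hL => h1 L (hD L hL).1) (fun L hL => h2 L (hD L hL).1)
    (fun L hL L' hL' hne => h3 L (hD L hL).1 L' (hD L' hL').1 hne) ?_
  intro l hl hll
  refine cost_clause_restrict_gen h4 hb hbl hcost l hl (fun L hL => (hD L (hll L hL)).1) (fun L hL => (hD L (hll L hL)).2) ?_
  intro L hL hLb
  exact not_disjoint_unionL_of_mem h2 hbl hLb (hD L (hll L hL)).2

include h1 h2 h3 in
/-- **A base of cost `≥ ν − 2` leaves at most two disjoint lines.** -/
theorem card_filter_disjoint_le_two_gen {ν : ℕ}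
    (h4 : ∀ l : List (Finset β), l.Nodup → (∀ L ∈ l, L ∈ ls) → wsum w (unionL l) ≤ ν + lineRank l)
    {b : List (Finset β)} (hb : b.Nodup) (hbl : ∀ L ∈ b, L ∈ ls) (hcost : ν + lineRank b ≤ 2 + wsum w (unionL b)) :
    (ls.filter (fun L => Disjoint L (unionL b))).card ≤ 2 := by
  have hD : ∀ L ∈ ls.filter (fun L => Disjoint L (unionL b)), L ∈ ls ∧ Disjoint L (unionL b) :=
    fun L hL => Finset.mem_filter.1 hL
  refine card_le_two_of_cost_two (fun L hL => h1 L (hD L hL).1) (fun L hL => h2 L (hD L hL).1)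
    (fun L hL L' hL' hne => h3 L (hD L hL).1 L' (hD L' hL').1 hne) ?_
  intro l hl hll
  refine cost_clause_restrict_gen h4 hb hbl hcost l hl (fun L hL => (hD L (hll L hL)).1) (fun L hL => (hD L (hll L hL)).2) ?_
  intro L hL hLb
  exact not_disjoint_unionL_of_mem h2 hbl hLb (hD L (hll L hL)).2

include h1 h2 h3 in
/-- **A base of cost `≥ ν − 3` leaves at most four disjoint lines** (`card_le_four` at nullity `3`). -/
theorem card_filter_disjoint_le_four_gen {ν : ℕ}
    (h4 : ∀ l : List (Finset β), l.Nodup → (∀ L ∈ l, L ∈ ls) → wsum w (unionL l) ≤ ν + lineRank l)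
    {b : List (Finset β)} (hb : b.Nodup) (hbl : ∀ L ∈ b, L ∈ ls) (hcost : ν + lineRank b ≤ 3 + wsum w (unionL b)) :
    (ls.filter (fun L => Disjoint L (unionL b))).card ≤ 4 := by
  have hD : ∀ L ∈ ls.filter (fun L => Disjoint L (unionL b)), L ∈ ls ∧ Disjoint L (unionL b) :=
    fun L hL => Finset.mem_filter.1 hL
  refine card_le_four (fun L hL => h1 L (hD L hL).1) (fun L hL => h2 L (hD L hL).1)
    (fun L hL L' hL' hne => h3 L (hD L hL).1 L' (hD L' hL').1 hne) ?_
  intro l hl hll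
  refine cost_clause_restrict_gen h4 hb hbl hcost l hl (fun L hL => (hD L (hll L hL)).1) (fun L hL => (hD L (hll L hL)).2) ?_
  intro L hL hLb
  exact not_disjoint_unionL_of_mem h2 hbl hLb (hD L (hll L hL)).2

end GenBase

section GenSimple

variable {w : β → ℕ} {ls : Finset (Finset β)}
  (hw1 : ∀ L ∈ ls, ∀ v ∈ L, w v = 1)
  (hcard : ∀ L ∈ ls, L.card = 3)
  (h3 : ∀ L ∈ ls, ∀ L' ∈ ls, L ≠ L' → (L ∩ L').card ≤ 1)

include hcard in
/-- **A list of pairwise disjoint simple lines** has rank bound `2n` on `3n` points. -/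
theorem disjoint_list : ∀ l : List (Finset β), l.Nodup → (∀ L ∈ l, L ∈ ls) →
    (∀ L ∈ l, ∀ L' ∈ l, L ≠ L' → Disjoint L L') →
    lineRank l = 2 * l.length ∧ (unionL l).card = 3 * l.length
  | [], _, _, _ => by simp [lineRank, unionL]
  | L :: l, hnd, hl, hd => by
    have hL := hl L List.mem_cons_self
    have hl' : ∀ L' ∈ l, L' ∈ ls := fun L' hL' => hl L' (List.mem_cons_of_mem _ hL')
    have hnd' := List.nodup_cons.1 hnd
    have hd' : ∀ L' ∈ l, ∀ L'' ∈ l, L' ≠ L'' → Disjoint L' L'' :=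
      fun L' hL' L'' hL'' hne => hd L' (List.mem_cons_of_mem _ hL') L'' (List.mem_cons_of_mem _ hL'') hne
    obtain ⟨ih1, ih2⟩ := disjoint_list l hnd'.2 hl' hd'
    have hdis : Disjoint L (unionL l) := by
      refine disjoint_unionL_of_forall (fun L' hL' => ?_) |>.symm
      exact (hd L List.mem_cons_self L' (List.mem_cons_of_mem _ hL') (fun h => hnd'.1 (h ▸ hL'))).symm
    have e1 : lineRank (L :: l) = lineRank l + min (L \ unionL l).card (2 - min (L ∩ unionL l).card 2) := rfl
    have e2 : unionL (L :: l) = L ∪ unionL l := rfl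
    have hi : (L ∩ unionL l).card = 0 := by
      rw [Finset.card_eq_zero]; exact Finset.disjoint_iff_inter_eq_empty.1 hdis
    have hs : L \ unionL l = L := Finset.sdiff_eq_self_of_disjoint hdis
    have hu : (L ∪ unionL l).card = L.card + (unionL l).card := Finset.card_union_of_disjoint hdis
    have kL := hcard L hL
    rw [e1, e2, hi, hs, ih1, hu, ih2, kL, List.length_cons]
    have : min 3 (2 - min 0 2) = 2 := by decide
    constructor
    · omega
    · omega

include hw1 hcard in
/-- **Pairwise disjoint simple lines number at most the nullity** (the list of all of them costs its length). -/
theorem card_le_nu_of_pairwise_disjoint {ν : ℕ}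
    (h4 : ∀ l : List (Finset β), l.Nodup → (∀ L ∈ l, L ∈ ls) → wsum w (unionL l) ≤ ν + lineRank l)
    (hdisj : ∀ L ∈ ls, ∀ L' ∈ ls, L ≠ L' → Disjoint L L') : ls.card ≤ ν := by
  have hl : ∀ L ∈ ls.toList, L ∈ ls := fun L hL => Finset.mem_toList.1 hL
  obtain ⟨h1, h2⟩ := disjoint_list hcard ls.toList (Finset.nodup_toList ls) hl
    (fun L hL L' hL' hne => hdisj L (hl L hL) L' (hl L' hL') hne)
  have hc := h4 ls.toList (Finset.nodup_toList ls) hl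
  rw [wsum_unionL_eq_card hw1 _ hl, h1, h2, Finset.length_toList] at hc
  omega

include hw1 hcard h3 in
/-- **Four simple lines of cost `≤ 3` contain a triangle**: each lies in the union of the other three (`mem_of_four`), so every two of
them meet; three pairwise meeting lines without a common point form a triangle, and four lines through one common point cannot cover
each other. -/
theorem triangle_of_four_cost_three
    (h4 : ∀ l : List (Finset β), l.Nodup → (∀ L ∈ l, L ∈ ls) → wsum w (unionL l) ≤ 3 + lineRank l)
    {A B C D : Finset β} (hA : A ∈ ls) (hB : B ∈ ls) (hC : C ∈ ls) (hD : D ∈ ls) (hBA : B ≠ A) (hCA : C ≠ A)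
    (hCB : C ≠ B) (hDA : D ≠ A) (hDB : D ≠ B) (hDC : D ≠ C) :
    ∃ X ∈ ls, ∃ Y ∈ ls, ∃ Z ∈ ls, X ≠ Y ∧ Y ≠ Z ∧ X ≠ Z ∧ (X ∩ Y).Nonempty ∧ (Y ∩ Z).Nonempty ∧ (X ∩ Z).Nonempty ∧
      X ∩ Y ∩ Z = ∅ := by
  have h1' := h1_of_simple hw1
  have h2' := h2_of_simple hw1 hcard
  -- every line meets every other: a line covered by three others with `≤ 1` point on each meets each once
  have hmeet : ∀ {X Y Z V : Finset β}, X ∈ ls → Y ∈ ls → Z ∈ ls → V ∈ ls → Y ≠ X → Z ≠ X → Z ≠ Y → V ≠ X → V ≠ Y → V ≠ Z →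
      (V ∩ X).Nonempty := by
    intro X Y Z V hX hY hZ hV hYX hZX hZY hVX hVY hVZ
    have hcov := mem_of_four h1' h2' h3 h4 hX hY hZ hV hYX hZX hZY hVX hVY hVZ
    have hsub : V ⊆ (V ∩ Z) ∪ ((V ∩ Y) ∪ (V ∩ X)) := by
      intro v hv
      rcases hcov v hv with h | h | h
      · exact Finset.mem_union_left _ (Finset.mem_inter.2 ⟨hv, h⟩)
      · exact Finset.mem_union_right _ (Finset.mem_union_left _ (Finset.mem_inter.2 ⟨hv, h⟩))
      · exact Finset.mem_union_right _ (Finset.mem_union_right _ (Finset.mem_inter.2 ⟨hv, h⟩))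
    have hc1 := Finset.card_le_card hsub
    have hc2 := Finset.card_union_le (V ∩ Z) ((V ∩ Y) ∪ (V ∩ X))
    have hc3 := Finset.card_union_le (V ∩ Y) (V ∩ X)
    have := h3 V hV Z hZ hVZ
    have := h3 V hV Y hY hVY
    have := hcard V hV
    exact Finset.card_pos.1 (by omega)
  have nAB : (A ∩ B).Nonempty := hmeet hB hC hD hA hCB hDB hDC hBA.symm hCA.symm hDA.symm
  have nBC : (B ∩ C).Nonempty := hmeet hC hA hD hB hCA.symm hDC hDA hCB.symm hBA hDB.symm
  have nAC : (A ∩ C).Nonempty := hmeet hC hB hD hA hCB.symm hDC hDB hCA.symm hBA.symm hDA.symm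
  have nAD : (A ∩ D).Nonempty := hmeet hD hB hC hA hDB.symm hDC.symm hCB hDA.symm hBA.symm hCA.symm
  have nBD : (B ∩ D).Nonempty := hmeet hD hA hC hB hDA.symm hDC.symm hCA hDB.symm hBA hCB.symm
  have nCD : (C ∩ D).Nonempty := hmeet hD hA hB hC hDA.symm hDB.symm hBA hDC.symm hCA hCB
  by_cases hABC : A ∩ B ∩ C = ∅
  · exact ⟨A, hA, B, hB, C, hC, hBA.symm, hCB.symm, hCA.symm, nAB, nBC, nAC, hABC⟩
  by_cases hABD : A ∩ B ∩ D = ∅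
  · exact ⟨A, hA, B, hB, D, hD, hBA.symm, hDB.symm, hDA.symm, nAB, nBD, nAD, hABD⟩
  exfalso
  -- `A, B, C` and `A, B, D` through common points `q`, `q'`; both lie in `A ∩ B`, so `q = q'` and `D ∩ A = D ∩ B = D ∩ C = {q}`
  obtain ⟨q, hq⟩ := Finset.nonempty_iff_ne_empty.2 hABC
  obtain ⟨q', hq'⟩ := Finset.nonempty_iff_ne_empty.2 hABD
  simp only [Finset.mem_inter] at hq hq'
  have hqq : q' = q := Finset.card_le_one.1 (h3 A hA B hB hBA.symm) q' (Finset.mem_inter.2 ⟨hq'.1.1, hq'.1.2⟩) q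
    (Finset.mem_inter.2 ⟨hq.1.1, hq.1.2⟩)
  subst hqq
  have hcov := mem_of_four h1' h2' h3 h4 hA hB hC hD hBA hCA hCB hDA hDB hDC
  have hsub : D ⊆ {q'} := by
    intro v hv
    rw [Finset.mem_singleton]
    rcases hcov v hv with h | h | h
    · exact Finset.card_le_one.1 (h3 D hD C hC hDC) v (Finset.mem_inter.2 ⟨hv, h⟩) q' (Finset.mem_inter.2 ⟨hq'.2, hq.2⟩)
    · exact Finset.card_le_one.1 (h3 D hD B hB hDB) v (Finset.mem_inter.2 ⟨hv, h⟩) q'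
        (Finset.mem_inter.2 ⟨hq'.2, hq'.1.2⟩)
    · exact Finset.card_le_one.1 (h3 D hD A hA hDA) v (Finset.mem_inter.2 ⟨hv, h⟩) q'
        (Finset.mem_inter.2 ⟨hq'.2, hq'.1.1⟩)
  have := Finset.card_le_card hsub
  rw [Finset.card_singleton, hcard D hD] at this
  omega

end GenSimple

end FourCap

end S1

end PercRepro
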